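import Mathlib
import HarnessLib
import Summits.Ventures.LatticeQCDFlow.Exactness.SphereExpMapChart

/-!
# The LOCAL chart comparison at the pole: `σ|_{cap(r)} ≤ t^{n+1} • (Lebesgue|_{‖y‖<r/t}).map (expBall n t)`

HONEST FRAMING: exact (Metropolis-corrected) sampling algorithms for lattice gauge theory;
figures of merit are autocorrelation/cost numbers at stated couplings and volumes; no
continuum-physics claim.

Venture `LatticeQCDFlow` (cell pub-lqcd), topic `Exactness`, FANOUT row 9 (eng-latcore, toward
multi-step HMC on the `cpn_2d` sphere family; design in HOME/eng-latcore/HANDOFF.md GEN-19).  NEW WORK of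
the cell over the tree (gen-16's `SphereExpMapChart.lean`: the exponential map at the pole in equatorial
coordinates `expBall n t`, the GLOBAL comparison `lintegral_toSphere_le_expBall` — `∫ G dσ ≤
t^{n+1} ∫_{‖y‖<π/t} G(expBall n t y) dy`; row 7's `SphereAxisCoordinates.lean`: `polarAxis`, `latitudePt`,
`inner_polarAxis_latitudePt`); nothing is cited as a fact; no number beyond the inherited `t^{n+1}`.

THE POINT.  Gen-16's chart minorisation is GLOBAL: the uniform law of the whole sphere is dominated by
Lebesgue measure on the tangent ball of radius `π/t` pushed through the time-`t` exponential map.  The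
multi-step argument (a Lipschitz-small perturbation of a dilation covers only a SMALL ball —
`LocalDilationPushforward.lean`) needs the LOCAL form: the uniform law RESTRICTED TO THE POLAR CAP of
angular radius `r` is dominated by Lebesgue measure on the tangent ball of radius `r/t` pushed through the
same map.  It follows from the global FUNCTION inequality applied to indicators: a tangent vector of
length `< π/t` lands in the cap iff its length is `< r/t` (`cos` is strictly decreasing on `[0, π]`).

* `polarCap n r = {x ∈ S^{n+1} : cos r < ⟪e₀, x⟫}` (`measurableSet_polarCap`),
  `inner_polarAxis_expBall` (`⟪e₀, expBall n t y⟫ = cos (‖y‖ t)`),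
  `expBall_mem_polarCap_iff` (`‖y‖ < π/t`, `0 ≤ r ≤ π`: in the cap iff `‖y‖ < r/t`),
  **`toSphere_restrict_polarCap_le`** — `σ|_{polarCap r} ≤ t^{n+1} • (Lebesgue|_{ball 0 (r/t)}).map (expBall n t)`
  for `t > 0`, `0 ≤ r ≤ π`.

NOT CLAIMED: the general pole / ambient-momentum form (rotate and integrate out the axis coordinate as in
`SphereExpMapMinorisation.lean` §2–3, with radii — the successor's item), equality, rates.
-/

noncomputable section

namespace Summit.Ventures.LatticeQCDFlow.Exactness

open MeasureTheory Measure Metric Set Real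
open scoped ENNReal InnerProductSpace

variable (n : ℕ)

/-- **The polar cap of angular radius `r`**: the points of `S^{n+1}` at angle `< r` from the pole `e₀`,
written as `cos r < ⟪e₀, x⟫`. -/
def polarCap (r : ℝ) : Set (sphere (0 : EuclideanSpace ℝ (Fin (n + 2))) 1) :=
  {x | cos r < ⟪polarAxis n, (x : EuclideanSpace ℝ (Fin (n + 2)))⟫_ℝ}

/-- Membership in the cap. -/
theorem mem_polarCap {r : ℝ} {x : sphere (0 : EuclideanSpace ℝ (Fin (n + 2))) 1} :
    x ∈ polarCap n r ↔ cos r < ⟪polarAxis n, (x : EuclideanSpace ℝ (Fin (n + 2)))⟫_ℝ := Iff.rfl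

/-- The cap is measurable (open). -/
theorem measurableSet_polarCap (r : ℝ) : MeasurableSet (polarCap n r) := by
  have hc : Continuous fun x : sphere (0 : EuclideanSpace ℝ (Fin (n + 2))) 1 =>
      ⟪polarAxis n, (x : EuclideanSpace ℝ (Fin (n + 2)))⟫_ℝ :=
    continuous_const.inner continuous_subtype_val
  exact (isOpen_lt continuous_const hc).measurableSet

/-- `⟪e₀, expBall n t y⟫ = cos (‖y‖ t)`. -/
theorem inner_polarAxis_expBall (t : ℝ) (y : EuclideanSpace ℝ (Fin (n + 1))) :
    ⟪polarAxis n, (expBall n t y : EuclideanSpace ℝ (Fin (n + 2)))⟫_ℝ = cos (‖y‖ * t) := by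
  rw [expBall, inner_polarAxis_latitudePt]

/-- **A tangent vector of length `< π/t` lands in the cap of radius `r ≤ π` iff its length is `< r/t`.** -/
theorem expBall_mem_polarCap_iff {t r : ℝ} (ht : 0 < t) (hr0 : 0 ≤ r) (hr : r ≤ π)
    {y : EuclideanSpace ℝ (Fin (n + 1))} (hy : ‖y‖ < π / t) :
    expBall n t y ∈ polarCap n r ↔ ‖y‖ < r / t := by
  rw [mem_polarCap, inner_polarAxis_expBall, lt_div_iff₀ ht]
  have h0 : 0 ≤ ‖y‖ * t := by positivity
  have hπ : ‖y‖ * t < π := by rwa [← lt_div_iff₀ ht]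
  constructor
  · intro h
    by_contra hle
    -- `r ≤ ‖y‖ t ≤ π` ⇒ `cos (‖y‖ t) ≤ cos r`
    exact absurd h (not_lt.2 (Real.cos_le_cos_of_nonneg_of_le_pi hr0 hπ.le (not_lt.1 hle)))
  · intro h
    exact Real.cos_lt_cos_of_nonneg_of_le_pi h0 hr h

/-- **THE LOCAL CHART COMPARISON AT THE POLE.**  For `t > 0` and `0 ≤ r ≤ π`: the surface measure of
`S^{n+1}` restricted to the polar cap of angular radius `r` is at most `t^{n+1}` times Lebesgue measure on
the tangent ball of radius `r/t` pushed through the time-`t` exponential map at the pole. -/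
theorem toSphere_restrict_polarCap_le {t r : ℝ} (ht : 0 < t) (hr0 : 0 ≤ r) (hr : r ≤ π) :
    (volume : Measure (EuclideanSpace ℝ (Fin (n + 2)))).toSphere.restrict (polarCap n r) ≤
      ENNReal.ofReal (t ^ (n + 1)) •
        ((volume : Measure (EuclideanSpace ℝ (Fin (n + 1)))).restrict (ball 0 (r / t))).map (expBall n t) := by
  refine Measure.le_iff.2 fun A hA => ?_
  have hcap := measurableSet_polarCap n r
  have hAc : MeasurableSet (A ∩ polarCap n r) := hA.inter hcap
  have hind : Measurable ((A ∩ polarCap n r).indicator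
      (1 : sphere (0 : EuclideanSpace ℝ (Fin (n + 2))) 1 → ℝ≥0∞)) := measurable_one.indicator hAc
  -- left side as an integral, global function inequality
  rw [Measure.restrict_apply hA, ← lintegral_indicator_one hAc]
  refine (lintegral_toSphere_le_expBall n ht hind).trans ?_
  rw [Measure.smul_apply, smul_eq_mul, Measure.map_apply (measurable_expBall n t) hA,
    Measure.restrict_apply ((measurable_expBall n t) hA)]
  gcongr
  -- the flat side: the indicator pulled back, and the cap forces `‖y‖ < r/t`
  have hpre : MeasurableSet (expBall n t ⁻¹' (A ∩ polarCap n r)) := (measurable_expBall n t) hAc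
  have hfun : (fun y : EuclideanSpace ℝ (Fin (n + 1)) =>
      (A ∩ polarCap n r).indicator (1 : sphere (0 : EuclideanSpace ℝ (Fin (n + 2))) 1 → ℝ≥0∞) (expBall n t y)) =
      (expBall n t ⁻¹' (A ∩ polarCap n r)).indicator 1 := by
    funext y
    by_cases hy : expBall n t y ∈ A ∩ polarCap n r
    · rw [indicator_of_mem hy, indicator_of_mem (show y ∈ expBall n t ⁻¹' (A ∩ polarCap n r) from hy)]
      rfl
    · rw [indicator_of_notMem hy, indicator_of_notMem (show y ∉ expBall n t ⁻¹' (A ∩ polarCap n r) from hy)]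
  rw [hfun, lintegral_indicator_one hpre, Measure.restrict_apply hpre]
  refine measure_mono fun y hy => ?_
  obtain ⟨⟨hyA, hyC⟩, hyb⟩ := hy
  rw [mem_ball_zero_iff] at hyb
  exact ⟨hyA, mem_ball_zero_iff.2 ((expBall_mem_polarCap_iff n ht hr0 hr hyb).1 hyC)⟩

end Summit.Ventures.LatticeQCDFlow.Exactness
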